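import Summits.ResolutionOfSingularities.ResolutionOfSingularities.Theorems.FrobeniusLadderFRationalResolutionFixedPointLocal
import Summits.ResolutionOfSingularities.ResolutionOfSingularities.Theorems.FrobeniusLadderFRationalResolutionAdjoinParameters
import Mathlib.RingTheory.Ideal.GoingUp
import Mathlib.RingTheory.Finiteness.Ideal
import Mathlib.RingTheory.Localization.Finiteness
import Mathlib.RingTheory.Localization.Basic
import HarnessLib

/-!
# Crux `FrobeniusLadder.FRationalResolution` (stmt-ResolutionOfSingularities-15317), line `redirect`,
# stub `stub_diagonalizableQuotientResolution` — `S_𝔔 = (S₀)_𝔮[x₁,…,x_n]` at a `D(A)`-fixed point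
# (linearisation step L3, brick 5)

Assembles `…AdjoinParameters.lean` (Nakayama), `…FixedPointLocal.lean` (`T⁻¹S = S_𝔔` is local) and
`…FixedPointFibre.lean` (residue surjectivity) into the structural statement used by Kato's
log-regularity of the quotient chart at a fixed point:

* `adjoin_eq_top_of_span_eq_maximalIdeal` — abstract form: a module-finite LOCAL extension `R → T`
  of local rings with `T` Noetherian, every element of `T` congruent to a scalar modulo `𝔪_T`, and
  `𝔪_T = (x₁,…,x_n)`, is `R[x₁,…,x_n]` (the hypothesis `𝔪_T^N ⊆ 𝔪_R T` of
  `adjoin_eq_top_of_residual_generators` is automatic: every prime over `𝔪_R T` is maximal by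
  integrality, so `√(𝔪_R T) = 𝔪_T`);
* `adjoin_eq_top_atPrime_of_fixed` — **at a fixed prime `𝔔` of a Noetherian graded `S` of finite
  type (torsion grading), for every localization `Rq` of `S₀` at `𝔮 = 𝔔 ∩ S₀` and `Lq` of `S` at
  `𝔔` and every finite `t ⊆ 𝔔` whose image generates `𝔪_{Lq}`: `Lq = Rq[t]`** (generic
  `IsLocalization.AtPrime` interfaces, so that it applies to the degree-`0` piece of the graded
  localization and to `Localization.AtPrime 𝔔` alike).

Honest label: elementary brick of L3 (no stub closed). No definitions, no named facts, no sorry.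
[folklore; cite: Matsumura1987, Thm. 8.4, Thm. 9.4] [cite: SGA3, Exp. VIII §4–5]
-/

noncomputable section

-- single-problem summit: the doubled namespace component is forced
set_option linter.dupNamespace false

open IsLocalRing
open Literature.AlgebraicGeometry.Resolution.DiagonalizableQuotient

namespace Summit.ResolutionOfSingularities.ResolutionOfSingularities.Theorems.FRationalResolution.FixedPointAdjoin

universe u v w

/-! ## Abstract form -/

/-- **A module-finite local extension with equal residue fields is generated by generators of its
maximal ideal.** `R` local, `T` local Noetherian and module-finite over `R`, every `t ∈ T` congruent
to a scalar modulo `𝔪_T`, `𝔪_T = (x₁,…,x_n)` ⇒ `T = R[x₁,…,x_n]`. (Primes containing `𝔪_R T`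
contract to `𝔪_R`, hence are maximal by integrality, so `𝔪_T ≤ √(𝔪_R T)` and some power of the
finitely generated `𝔪_T` lies in `𝔪_R T`; then `AdjoinParameters.adjoin_eq_top_of_residual_generators`.)
[folklore; cite: Matsumura1987, Thm. 8.4, Thm. 9.4] -/
theorem adjoin_eq_top_of_span_eq_maximalIdeal {R : Type u} {T : Type v} [CommRing R] [CommRing T]
    [Algebra R T] [IsLocalRing R] [IsLocalRing T] [IsNoetherianRing T] [Module.Finite R T]
    {n : ℕ} (x : Fin n → T) (hx : Ideal.span (Set.range x) = maximalIdeal T)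
    (hres : ∀ t : T, ∃ r : R, t - algebraMap R T r ∈ maximalIdeal T) :
    Algebra.adjoin R (Set.range x) = ⊤ := by
  haveI : Algebra.IsIntegral R T := Algebra.IsIntegral.of_finite R T
  have hrad : maximalIdeal T ≤ ((maximalIdeal R).map (algebraMap R T)).radical := by
    rw [Ideal.radical_eq_sInf]
    refine le_sInf ?_
    rintro J ⟨hJ, hJprime⟩
    haveI := hJprime
    have hle : maximalIdeal R ≤ J.comap (algebraMap R T) := by
      rw [← Ideal.map_le_iff_le_comap]
      exact hJ
    have hne : J.comap (algebraMap R T) ≠ ⊤ := (Ideal.IsPrime.comap (algebraMap R T)).ne_top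
    have hcomap : (J.comap (algebraMap R T)).IsMaximal := by
      rw [← (maximalIdeal.isMaximal R).eq_of_le hne hle]
      exact maximalIdeal.isMaximal R
    have hJmax : J.IsMaximal := Ideal.isMaximal_of_isIntegral_of_isMaximal_comap J hcomap
    exact (eq_maximalIdeal hJmax).ge
  obtain ⟨N, hN⟩ := Ideal.exists_pow_le_of_le_radical_of_fg hrad (IsNoetherian.noetherian _)
  refine AdjoinParameters.adjoin_eq_top_of_residual_generators x ?_ ⟨N, ?_⟩
  · intro t
    obtain ⟨r, hr⟩ := hres t
    exact ⟨r, hx ▸ hr⟩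
  · rw [hx]
    exact hN

/-! ## At a fixed point of a graded ring -/

section Graded

variable {k : Type u} [Field k] {A : Type w} [DecidableEq A] [AddCommGroup A] {S : Type u}
  [CommRing S] [Algebra k S] (𝒮 : A → Submodule k S) [GradedAlgebra 𝒮]

/-- **`S_𝔔 = (S₀)_𝔮[x₁,…,x_n]` at a fixed point.** Let `S` be Noetherian of finite type over a field,
graded by a torsion group, `𝔔 ⊇ S_a` (`a ≠ 0`) a prime, `𝔮 = 𝔔 ∩ S₀`, `Rq` a localization of `S₀`
at `𝔮` and `Lq` a localization of `S` at `𝔔` over it. If `t ⊆ S` is finite and its image generates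
the maximal ideal of `Lq`, then `Lq` is generated by the image of `t` as an `Rq`-algebra: `Lq` is
also `S ⊗_{S₀} Rq` (`FixedPointLocal.isLocalization_atPrime_of_fixed`), hence module-finite over
`Rq` (`S` is finite over `S₀`), and its residue field is that of `Rq`
(`FixedPointFibre.sub_decompose_zero_mem`). [folklore; cite: SGA3, Exp. VIII §4–5] -/
theorem adjoin_eq_top_atPrime_of_fixed [IsNoetherianRing S] [Algebra.FiniteType k S]
    (hA : AddMonoid.IsTorsion A) (𝔔 : Ideal S) [𝔔.IsPrime]
    (hfix : ∀ a : A, a ≠ 0 → ∀ s ∈ 𝒮 a, s ∈ 𝔔)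
    (Rq : Type u) [CommRing Rq] [Algebra (𝒮 0) Rq]
    [IsLocalization.AtPrime Rq (𝔔.comap (algebraMap (𝒮 0) S))]
    (Lq : Type u) [CommRing Lq] [Algebra S Lq] [IsLocalization.AtPrime Lq 𝔔] [IsLocalRing Lq]
    [Algebra Rq Lq] [Algebra (𝒮 0) Lq] [IsScalarTower (𝒮 0) S Lq] [IsScalarTower (𝒮 0) Rq Lq]
    (t : Finset S)
    (htspan : Ideal.span (algebraMap S Lq '' (↑t : Set S)) = maximalIdeal Lq) :
    Algebra.adjoin Rq (algebraMap S Lq '' (↑t : Set S)) = ⊤ := by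
  classical
  set 𝔮 : Ideal (𝒮 0) := 𝔔.comap (algebraMap (𝒮 0) S) with h𝔮
  set T : Submonoid S := 𝔮.primeCompl.map (algebraMap (𝒮 0) S) with hT
  -- `Lq` is also the localization of `S` at `T = S₀ ∖ 𝔮`
  haveI hLT : IsLocalization.AtPrime (Localization T) 𝔔 :=
    FixedPointLocal.isLocalization_atPrime_of_fixed 𝒮 hA 𝔔 hfix (Localization T)
  let e : Localization T ≃ₐ[S] Lq :=
    IsLocalization.algEquiv 𝔔.primeCompl (Localization T) Lq
  haveI : IsLocalization T Lq := IsLocalization.isLocalization_of_algEquiv T e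
  haveI : IsLocalization (Algebra.algebraMapSubmonoid S 𝔮.primeCompl) Lq := this
  -- module-finite over `Rq`
  haveI : Module.Finite (𝒮 0) S := module_finite_gradeZero 𝒮 hA
  haveI : Module.Finite Rq Lq := Module.Finite.of_isLocalization (𝒮 0) S 𝔮.primeCompl
  -- local rings
  haveI : IsLocalRing Rq := IsLocalization.AtPrime.isLocalRing Rq 𝔮
  haveI : IsNoetherianRing Lq := IsLocalization.isNoetherianRing 𝔔.primeCompl Lq inferInstance
  -- reindex the generators by `Fin`
  let x : Fin t.card → Lq := fun i => algebraMap S Lq (t.equivFin.symm i)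
  have hrange : Set.range x = algebraMap S Lq '' (↑t : Set S) := by
    ext y
    constructor
    · rintro ⟨i, rfl⟩
      exact ⟨_, (t.equivFin.symm i).2, rfl⟩
    · rintro ⟨s, hs, rfl⟩
      exact ⟨t.equivFin ⟨s, hs⟩, by simp [x]⟩
  rw [← hrange]
  refine adjoin_eq_top_of_span_eq_maximalIdeal x (hrange ▸ htspan) fun l => ?_
  -- residue surjectivity: `l = s/u` with `u ∈ S₀ ∖ 𝔮`, and `s ≡ s₀ (mod 𝔔)`
  obtain ⟨s, ⟨u, hu⟩, rfl⟩ := IsLocalization.exists_mk'_eq T l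
  obtain ⟨u₀, hu₀, rfl⟩ := (Submonoid.mem_map).mp hu
  refine ⟨IsLocalization.mk' Rq (DirectSum.decompose 𝒮 s 0) ⟨u₀, hu₀⟩, ?_⟩
  rw [IsLocalization.algebraMap_mk' S Rq Lq]
  have hsub : s - (DirectSum.decompose 𝒮 s 0 : S) ∈ 𝔔 :=
    FixedPointFibre.sub_decompose_zero_mem 𝒮 𝔔 hfix s
  have h1 : IsLocalization.mk' Lq s ⟨algebraMap (𝒮 0) S u₀, hu⟩ =
      algebraMap S Lq s * IsLocalization.mk' Lq 1 ⟨algebraMap (𝒮 0) S u₀, hu⟩ :=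
    IsLocalization.mk'_eq_mul_mk'_one _ _
  have h2 : IsLocalization.mk' Lq (algebraMap (𝒮 0) S (DirectSum.decompose 𝒮 s 0))
        ⟨algebraMap (𝒮 0) S u₀, Algebra.mem_algebraMapSubmonoid_of_mem
          (S := S) (M := 𝔮.primeCompl) ⟨u₀, hu₀⟩⟩ =
      algebraMap S Lq (DirectSum.decompose 𝒮 s 0 : S) *
        IsLocalization.mk' Lq 1 ⟨algebraMap (𝒮 0) S u₀, hu⟩ :=
    IsLocalization.mk'_eq_mul_mk'_one _ _
  rw [h1, h2, ← sub_mul, ← map_sub]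
  refine Ideal.mul_mem_right _ _ ?_
  exact (IsLocalization.AtPrime.to_map_mem_maximal_iff Lq 𝔔 _).mpr hsub

end Graded

end Summit.ResolutionOfSingularities.ResolutionOfSingularities.Theorems.FRationalResolution.FixedPointAdjoin

end
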